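import Summits.AtomisticToContinuum.Crystallization.Theorems.FrustratedLawDichotomyStrainedPatchHomHessPath

/-!
# The TWO-SIDED second-order expansion of the per-label SLOPE form (real side of the centred slope leaf `slopeCheckC`)

decomp-a2c hand-1 g28 (crux `AperiodicFrustratedLawGap`, stmt-AtomisticToContinuum-27623; `(H) HomFloor (1/625)`, hcp half; lever (C),
critic row 1083 (B): «naive slope bound kills `entryLeafOKHC` at hcp⋆ ⇒ centred slope leaf»).  One derivative LOWER than
`…HomHessPath.pathForm_secondOrder`: for the vector field `c ↦ B(‖c‖)·c` (`B = W₄₅′/ρ`) tested against a direction `Δ`,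

  `g(s) = B(ρ_s)·⟪p + s d, Δ⟫`, `ρ_s = ‖p + s d‖`, `σ = ρ′`,
  `g′ = B₁(ρ)σ⟪p + s d, Δ⟫ + B(ρ)⟪d, Δ⟫`, `g″ = (B₂σ² + B₁σ′)⟪p + s d, Δ⟫ + 2B₁σ⟪d, Δ⟫`,
  `|g″| ≤ (|B₂|ρ + 3|B₁|)·‖d‖²‖Δ‖` on the tube, hence

  ★★★ `|B(‖p+d‖)⟪p+d,Δ⟫ − B(‖p‖)⟪p,Δ⟫ − (B₁(‖p‖)(⟪p,d⟫/‖p‖)⟪p,Δ⟫ + B(‖p‖)⟪d,Δ⟫)| ≤ (K/2)‖d‖²‖Δ‖`  (`slopeForm_secondOrder`),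

with `K ≥ |B₂ r|·r + 3|B₁ r|` on the tube (for `W₄₅`: `B₁ = αρ`, `B₂ = α′ρ + α`).  Plus the generic two-sided Taylor estimate on `[0,1]`
(`taylor2_lower`, `taylor2_abs`) extracted from the proof pattern of `pathForm_secondOrder`.

NO definitions; 0 sorry; standard axioms; no instances / notation / `#eval`.  `--supports stmt-AtomisticToContinuum-27623`.
-/

noncomputable section

namespace Summit.AtomisticToContinuum.Crystallization.Theorems.FrustratedLawDichotomyStrainedPatchHomSlopePath

open scoped RealInnerProductSpace
open Summit.AtomisticToContinuum.Crystallization.Theorems.FrustratedLawDichotomyStrainedPatchTaylorChord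
  (segR segN segS segN_eq_inner hasDerivAt_segR hasDerivAt_segS segS_sq_le)
open Summit.AtomisticToContinuum.Crystallization.Theorems.FrustratedLawDichotomyStrainedPatchHomConvexSegment (le_of_deriv_nonneg_piece)
open Summit.AtomisticToContinuum.Crystallization.Theorems.FrustratedLawDichotomyStrainedPatchHomHessPath
  (inner_path_eq hasDerivAt_inner_path abs_segS_le segS_deriv_bounds)

/-! ## §1. Generic two-sided second-order Taylor estimate on `[0,1]` -/

/-- ★ One-sided: `g′ = g1`, `g1′ = g2 ≥ −L` on `[0,1]` ⟹ `g 0 + g1 0 − L/2 ≤ g 1`. [folklore: monotonicity twice] -/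
theorem taylor2_lower {g g1 g2 : ℝ → ℝ} {L : ℝ}
    (hd1 : ∀ t ∈ Set.Icc (0 : ℝ) 1, HasDerivAt g (g1 t) t) (hd2 : ∀ t ∈ Set.Icc (0 : ℝ) 1, HasDerivAt g1 (g2 t) t)
    (hfl : ∀ t ∈ Set.Icc (0 : ℝ) 1, -L ≤ g2 t) : g 0 + g1 0 - L / 2 ≤ g 1 := by
  -- step 1: `ψ = g1 + L·id` is non-decreasing, so `g1 0 ≤ g1 t + L t`
  have hψ : ∀ t ∈ Set.Icc (0 : ℝ) 1, g1 0 ≤ g1 t + L * t := by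
    intro t ht
    have hsub : ∀ s ∈ Set.Icc (0 : ℝ) t, s ∈ Set.Icc (0 : ℝ) 1 := fun s hs => ⟨hs.1, hs.2.trans ht.2⟩
    have hder : ∀ s ∈ Set.Icc (0 : ℝ) t, HasDerivAt (fun x => g1 x + L * x) (g2 s + L) s := fun s hs =>
      ((hd2 s (hsub s hs)).add ((hasDerivAt_id' s).const_mul L)).congr_deriv (by ring)
    have hcont : ContinuousOn (fun x => g1 x + L * x) (Set.Icc 0 t) := fun s hs => (hder s hs).continuousAt.continuousWithinAt
    have key := le_of_deriv_nonneg_piece ht.1 hcont (fun s hs => hder s (Set.Ioo_subset_Icc_self hs))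
      (fun s hs => by linarith [hfl s (hsub s (Set.Ioo_subset_Icc_self hs))])
    simpa using key
  -- step 2: `φ = g − g1(0)·id + (L/2)·id²` is non-decreasing on `[0,1]`
  have hφder : ∀ t ∈ Set.Icc (0 : ℝ) 1, HasDerivAt (fun x => g x - g1 0 * x + L / 2 * (x * x)) (g1 t - g1 0 + L * t) t := by
    intro t ht
    have h := ((hd1 t ht).sub ((hasDerivAt_id' t).const_mul (g1 0))).add (((hasDerivAt_id' t).mul (hasDerivAt_id' t)).const_mul (L / 2))
    exact h.congr_deriv (by ring)
  have hφcont : ContinuousOn (fun x => g x - g1 0 * x + L / 2 * (x * x)) (Set.Icc 0 1) :=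
    fun s hs => (hφder s hs).continuousAt.continuousWithinAt
  have hφ := le_of_deriv_nonneg_piece zero_le_one hφcont (fun s hs => hφder s (Set.Ioo_subset_Icc_self hs))
    (fun s hs => by linarith [hψ s (Set.Ioo_subset_Icc_self hs)])
  have hφ' : g 0 ≤ g 1 - g1 0 + L / 2 := by
    have := hφ
    simp only [mul_zero, sub_zero, add_zero, mul_one] at this
    linarith
  linarith

/-- ★ Two-sided: `|g2| ≤ L` on `[0,1]` ⟹ `|g 1 − g 0 − g1 0| ≤ L/2`. [folklore] -/
theorem taylor2_abs {g g1 g2 : ℝ → ℝ} {L : ℝ}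
    (hd1 : ∀ t ∈ Set.Icc (0 : ℝ) 1, HasDerivAt g (g1 t) t) (hd2 : ∀ t ∈ Set.Icc (0 : ℝ) 1, HasDerivAt g1 (g2 t) t)
    (hbd : ∀ t ∈ Set.Icc (0 : ℝ) 1, |g2 t| ≤ L) : |g 1 - g 0 - g1 0| ≤ L / 2 := by
  have h1 := taylor2_lower hd1 hd2 (fun t ht => by linarith [(abs_le.1 (hbd t ht)).1])
  have h2 := taylor2_lower (g := fun t => -g t) (g1 := fun t => -g1 t) (g2 := fun t => -g2 t) (L := L)
    (fun t ht => (hd1 t ht).neg) (fun t ht => (hd2 t ht).neg) (fun t ht => by linarith [(abs_le.1 (hbd t ht)).2])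
  exact abs_le.2 ⟨by linarith, by linarith⟩

/-! ## §2. Derivatives of the slope form `g(s) = B(ρ_s)⟪p + s d, Δ⟫` -/

/-- ★ First derivative: `g′ = B₁(ρ)σ⟪p + s d, Δ⟫ + B(ρ)⟪d, Δ⟫`. [folklore: chain and product rules] -/
theorem hasDerivAt_slopeForm {B B₁ : ℝ → ℝ} {p d Δ : EuclideanSpace ℝ (Fin 3)} {t : ℝ} (h0 : segR p d t ≠ 0)
    (hB : HasDerivAt B (B₁ (segR p d t)) (segR p d t)) :
    HasDerivAt (fun s : ℝ => B (segR p d s) * ⟪p + s • d, Δ⟫)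
      (B₁ (segR p d t) * segS p d t * ⟪p + t • d, Δ⟫ + B (segR p d t) * ⟪d, Δ⟫) t := by
  have hρ := hasDerivAt_segR (p := p) (Δ := d) h0
  have hBc : HasDerivAt (fun s => B (segR p d s)) (B₁ (segR p d t) * segS p d t) t := hB.comp t hρ
  have hu := hasDerivAt_inner_path p d Δ t
  exact (hBc.mul hu).congr_deriv (by ring)

/-- ★ Second derivative: with `σ′ = (‖d‖²ρ − Nσ)/ρ²`, `g″ = (B₂σ² + B₁σ′)⟪p + s d, Δ⟫ + 2B₁σ⟪d, Δ⟫`. [folklore: chain and product rules] -/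
theorem hasDerivAt_slopeForm_deriv {B B₁ B₂ : ℝ → ℝ} {p d Δ : EuclideanSpace ℝ (Fin 3)} {t : ℝ} (h0 : segR p d t ≠ 0)
    (hB : HasDerivAt B (B₁ (segR p d t)) (segR p d t)) (hB₁ : HasDerivAt B₁ (B₂ (segR p d t)) (segR p d t)) :
    HasDerivAt (fun s : ℝ => B₁ (segR p d s) * segS p d s * ⟪p + s • d, Δ⟫ + B (segR p d s) * ⟪d, Δ⟫)
      ((B₂ (segR p d t) * segS p d t ^ 2 + B₁ (segR p d t) * ((‖d‖ ^ 2 * segR p d t - segN p d t * segS p d t) / segR p d t ^ 2)) *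
          ⟪p + t • d, Δ⟫ + 2 * B₁ (segR p d t) * segS p d t * ⟪d, Δ⟫) t := by
  have hρ := hasDerivAt_segR (p := p) (Δ := d) h0
  have hσ := hasDerivAt_segS (p := p) (Δ := d) h0
  have hBc : HasDerivAt (fun s => B (segR p d s)) (B₁ (segR p d t) * segS p d t) t := hB.comp t hρ
  have hB₁c : HasDerivAt (fun s => B₁ (segR p d s)) (B₂ (segR p d t) * segS p d t) t := hB₁.comp t hρ
  have hu := hasDerivAt_inner_path p d Δ t
  have h1 := (hB₁c.mul hσ).mul hu
  have h2 := hBc.mul_const ⟪d, Δ⟫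
  exact (h1.add h2).congr_deriv (by simp only [Pi.mul_apply]; ring)

/-! ## §3. The pointwise bound of `g″` -/

/-- ★ **Pointwise bound of the second derivative.**  With `|σ| ≤ ‖d‖` (as `σ² ≤ nd²`), `0 ≤ σ′ ≤ ‖d‖²/ρ`, `|⟪p + s d, Δ⟫| ≤ ρ‖Δ‖`,
`|⟪d, Δ⟫| ≤ ‖d‖‖Δ‖` and `|B2|ρ + 3|B1| ≤ K`: `|(B2σ² + B1σ′)u + 2B1σ m| ≤ K‖d‖²‖Δ‖`. [folklore] -/
theorem secondDeriv_abs_le {B1 B2 K ρ σ τ u m nd nΔ : ℝ} (hρ : 0 < ρ) (hnd : 0 ≤ nd) (hnΔ : 0 ≤ nΔ)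
    (hσ : σ ^ 2 ≤ nd ^ 2) (hτ0 : 0 ≤ τ) (hτ : τ ≤ nd ^ 2 / ρ) (hu : |u| ≤ ρ * nΔ) (hm : |m| ≤ nd * nΔ)
    (hK : |B2| * ρ + 3 * |B1| ≤ K) :
    |(B2 * σ ^ 2 + B1 * τ) * u + 2 * B1 * σ * m| ≤ K * nd ^ 2 * nΔ := by
  have hσa : |σ| ≤ nd := abs_le_of_sq_le_sq hσ hnd
  have h1 : |B2 * σ ^ 2 * u| ≤ |B2| * ρ * (nd ^ 2 * nΔ) := by
    rw [abs_mul, abs_mul, abs_of_nonneg (sq_nonneg σ)]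
    calc |B2| * σ ^ 2 * |u| ≤ |B2| * nd ^ 2 * (ρ * nΔ) := mul_le_mul (mul_le_mul_of_nonneg_left hσ (abs_nonneg _)) hu (abs_nonneg _) (by positivity)
      _ = |B2| * ρ * (nd ^ 2 * nΔ) := by ring
  have h2 : |B1 * τ * u| ≤ |B1| * (nd ^ 2 * nΔ) := by
    rw [abs_mul, abs_mul, abs_of_nonneg hτ0]
    calc |B1| * τ * |u| ≤ |B1| * (nd ^ 2 / ρ) * (ρ * nΔ) := mul_le_mul (mul_le_mul_of_nonneg_left hτ (abs_nonneg _)) hu (abs_nonneg _) (by positivity)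
      _ = |B1| * (nd ^ 2 * nΔ) := by field_simp
  have h3 : |2 * B1 * σ * m| ≤ 2 * |B1| * (nd ^ 2 * nΔ) := by
    rw [abs_mul, abs_mul, abs_mul, abs_of_pos (by norm_num : (0 : ℝ) < 2)]
    calc 2 * |B1| * |σ| * |m| ≤ 2 * |B1| * nd * (nd * nΔ) := mul_le_mul (mul_le_mul_of_nonneg_left hσa (by positivity)) hm (abs_nonneg _) (by positivity)
      _ = 2 * |B1| * (nd ^ 2 * nΔ) := by ring
  have hsplit : (B2 * σ ^ 2 + B1 * τ) * u + 2 * B1 * σ * m = B2 * σ ^ 2 * u + B1 * τ * u + 2 * B1 * σ * m := by ring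
  rw [hsplit]
  have hw : 0 ≤ nd ^ 2 * nΔ := by positivity
  calc |B2 * σ ^ 2 * u + B1 * τ * u + 2 * B1 * σ * m| ≤ |B2 * σ ^ 2 * u| + |B1 * τ * u| + |2 * B1 * σ * m| := abs_add_three _ _ _
    _ ≤ |B2| * ρ * (nd ^ 2 * nΔ) + |B1| * (nd ^ 2 * nΔ) + 2 * |B1| * (nd ^ 2 * nΔ) := by linarith
    _ = (|B2| * ρ + 3 * |B1|) * (nd ^ 2 * nΔ) := by ring
    _ ≤ K * (nd ^ 2 * nΔ) := mul_le_mul_of_nonneg_right hK hw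
    _ = K * nd ^ 2 * nΔ := by ring

/-! ## §4. ★★★ The two-sided expansion of the slope form -/

/-- ★★★ **TWO-SIDED SECOND-ORDER EXPANSION OF THE PER-LABEL SLOPE FORM.**  Tube `a < ‖p + t d‖ < b` for `t ∈ [0,1]` (`a > 0`); on `(a, b)`:
`B′ = B₁`, `B₁′ = B₂` and `|B₂ r|·r + 3|B₁ r| ≤ K`.  Then
`|B(‖p+d‖)⟪p+d,Δ⟫ − B(‖p‖)⟪p,Δ⟫ − (B₁(‖p‖)(⟪p,d⟫/‖p‖)⟪p,Δ⟫ + B(‖p‖)⟪d,Δ⟫)| ≤ (K/2)‖d‖²‖Δ‖`. [folklore: Taylor with second-order remainder] -/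
theorem slopeForm_secondOrder {B B₁ B₂ : ℝ → ℝ} {a b K : ℝ} {p d Δ : EuclideanSpace ℝ (Fin 3)} (ha : 0 < a)
    (htube : ∀ t ∈ Set.Icc (0 : ℝ) 1, a < segR p d t ∧ segR p d t < b)
    (hB : ∀ r, a < r → r < b → HasDerivAt B (B₁ r) r) (hB₁ : ∀ r, a < r → r < b → HasDerivAt B₁ (B₂ r) r)
    (hK : ∀ r, a < r → r < b → |B₂ r| * r + 3 * |B₁ r| ≤ K) :
    |B ‖p + d‖ * ⟪p + d, Δ⟫ - B ‖p‖ * ⟪p, Δ⟫ - (B₁ ‖p‖ * (⟪p, d⟫ / ‖p‖) * ⟪p, Δ⟫ + B ‖p‖ * ⟪d, Δ⟫)| ≤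
      K / 2 * ‖d‖ ^ 2 * ‖Δ‖ := by
  set g : ℝ → ℝ := fun s => B (segR p d s) * ⟪p + s • d, Δ⟫ with hg
  set g1 : ℝ → ℝ := fun s => B₁ (segR p d s) * segS p d s * ⟪p + s • d, Δ⟫ + B (segR p d s) * ⟪d, Δ⟫ with hg1
  set g2 : ℝ → ℝ := fun t =>
    (B₂ (segR p d t) * segS p d t ^ 2 + B₁ (segR p d t) * ((‖d‖ ^ 2 * segR p d t - segN p d t * segS p d t) / segR p d t ^ 2)) *
        ⟪p + t • d, Δ⟫ + 2 * B₁ (segR p d t) * segS p d t * ⟪d, Δ⟫ with hg2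
  set L : ℝ := K * ‖d‖ ^ 2 * ‖Δ‖ with hL
  have hpos : ∀ t ∈ Set.Icc (0 : ℝ) 1, 0 < segR p d t := fun t ht => ha.trans (htube t ht).1
  have hd1 : ∀ t ∈ Set.Icc (0 : ℝ) 1, HasDerivAt g (g1 t) t := fun t ht =>
    hasDerivAt_slopeForm (hpos t ht).ne' (hB _ (htube t ht).1 (htube t ht).2)
  have hd2 : ∀ t ∈ Set.Icc (0 : ℝ) 1, HasDerivAt g1 (g2 t) t := fun t ht =>
    hasDerivAt_slopeForm_deriv (hpos t ht).ne' (hB _ (htube t ht).1 (htube t ht).2) (hB₁ _ (htube t ht).1 (htube t ht).2)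
  have hbd : ∀ t ∈ Set.Icc (0 : ℝ) 1, |g2 t| ≤ L := by
    intro t ht
    have h0 := hpos t ht
    have hτ := segS_deriv_bounds (p := p) (d := d) h0
    have hu : |⟪p + t • d, Δ⟫| ≤ segR p d t * ‖Δ‖ := by rw [segR]; exact abs_real_inner_le_norm _ _
    have hm : |⟪d, Δ⟫| ≤ ‖d‖ * ‖Δ‖ := abs_real_inner_le_norm _ _
    exact secondDeriv_abs_le h0 (norm_nonneg d) (norm_nonneg Δ) (segS_sq_le h0) hτ.1 hτ.2 hu hm
      (hK _ (htube t ht).1 (htube t ht).2)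
  have key := taylor2_abs hd1 hd2 hbd
  have hR0 : segR p d 0 = ‖p‖ := by simp [segR]
  have hR1 : segR p d 1 = ‖p + d‖ := by simp [segR]
  have hS0 : segS p d 0 = ⟪p, d⟫ / ‖p‖ := by simp [segS, segN, segR]
  have hg0 : g 0 = B ‖p‖ * ⟪p, Δ⟫ := by simp [hg, hR0]
  have hgone : g 1 = B ‖p + d‖ * ⟪p + d, Δ⟫ := by simp [hg, hR1]
  have hg10 : g1 0 = B₁ ‖p‖ * (⟪p, d⟫ / ‖p‖) * ⟪p, Δ⟫ + B ‖p‖ * ⟪d, Δ⟫ := by simp [hg1, hR0, hS0]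
  rw [hg0, hgone, hg10, hL] at key
  have e : K * ‖d‖ ^ 2 * ‖Δ‖ / 2 = K / 2 * ‖d‖ ^ 2 * ‖Δ‖ := by ring
  rw [e] at key
  exact key

end Summit.AtomisticToContinuum.Crystallization.Theorems.FrustratedLawDichotomyStrainedPatchHomSlopePath

end
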